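import Summits.AtomisticToContinuum.FouriersLaw.Theses.ContactEchoEpochs

/-!
# `EchoLimitOfWindows` — the three time epochs give the contact-echo limit

Route `ContactEchoEpochs`, support item stmt-AtomisticToContinuum-11824.

We prove `ContactKubo → NessUnique → DarkTime → EquilibriumFluctuationWindow → PolynomialGapTail →
EchoLimit`: with `c_N ∈ L¹(0,∞)` (from `ContactKubo` fed `NessUnique`), split
`∫₀^∞ c_N = ∫₀^(N/v) c_N + ∫_(N/v)^(N^a) c_N + ∫_(N^a)^∞ c_N` for `N/v ≤ N^a` (eventually in `N`),
bound the outer pieces by the `∫ |c_N|` of `DarkTime` / `PolynomialGapTail`, and squeeze onto the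
`κ` of `EquilibriumFluctuationWindow` taken at `(v, a)`.  Pure real analysis; the splitting is done
once for an abstract family `c : ℕ → ℝ → ℝ` (`tendsto_setIntegral_Ioi_of_three_windows`).
-/

namespace Summit.AtomisticToContinuum.FouriersLaw.Theorems

open Filter Set MeasureTheory
open scoped Topology

/-- Abstract three-epoch splitting: if `c n` is integrable on `(0, ∞)`, the weighted mass of `|c n|`
on `[0, (n+2)/v]` and on `((n+2)^a, ∞)` tends to `0`, and the weighted integral of `c n` over the
middle window `[(n+2)/v, (n+2)^a]` tends to `κ`, then the weighted integral over `(0, ∞)` tends to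
`κ` (weight `(n+1)/T²`; only `0 < v` and `2 ≤ a`-type growth is used, via `(n+2)/v ≤ (n+2)^a`
eventually). -/
theorem tendsto_setIntegral_Ioi_of_three_windows (c : ℕ → ℝ → ℝ) (T v a κ : ℝ) (hv : 0 < v)
    (ha : 2 < a) (hint : ∀ n, IntegrableOn (c n) (Ioi 0))
    (hW1 : Tendsto (fun n : ℕ => ((n : ℝ) + 1) / T ^ 2 *
      ∫ t in Icc 0 (((n : ℝ) + 2) / v), |c n t|) atTop (𝓝 0))
    (hW2 : Tendsto (fun n : ℕ => ((n : ℝ) + 1) / T ^ 2 *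
      ∫ t in Icc (((n : ℝ) + 2) / v) (((n : ℝ) + 2) ^ a), c n t) atTop (𝓝 κ))
    (hW3 : Tendsto (fun n : ℕ => ((n : ℝ) + 1) / T ^ 2 *
      ∫ t in Ioi (((n : ℝ) + 2) ^ a), |c n t|) atTop (𝓝 0)) :
    Tendsto (fun n : ℕ => ((n : ℝ) + 1) / T ^ 2 * ∫ t in Ioi 0, c n t) atTop (𝓝 κ) := by
  -- eventually the windows are ordered: `(n+2)/v ≤ (n+2)^a`
  obtain ⟨N₀, hN₀⟩ := exists_nat_ge (1 / v)
  have hev : ∀ᶠ n : ℕ in atTop, ((n : ℝ) + 2) / v ≤ ((n : ℝ) + 2) ^ a := by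
    refine eventually_atTop.2 ⟨N₀, fun n hn => ?_⟩
    have hn0 : (0 : ℝ) ≤ n := Nat.cast_nonneg n
    have hn2 : (1 : ℝ) ≤ (n : ℝ) + 2 := by linarith
    have hNn : (N₀ : ℝ) ≤ (n : ℝ) := by exact_mod_cast hn
    have h1 : 1 / v ≤ (n : ℝ) + 2 := by linarith
    calc ((n : ℝ) + 2) / v = ((n : ℝ) + 2) * (1 / v) := by ring
      _ ≤ ((n : ℝ) + 2) * ((n : ℝ) + 2) := mul_le_mul_of_nonneg_left h1 (by linarith)
      _ = ((n : ℝ) + 2) ^ (2 : ℝ) := by rw [Real.rpow_two]; ring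
      _ ≤ ((n : ℝ) + 2) ^ a := Real.rpow_le_rpow_of_exponent_le hn2 ha.le
  -- the key bound: |whole − middle| ≤ left mass + right mass, eventually
  have hbound : ∀ᶠ n : ℕ in atTop,
      ‖((n : ℝ) + 1) / T ^ 2 * (∫ t in Ioi 0, c n t) -
        ((n : ℝ) + 1) / T ^ 2 * ∫ t in Icc (((n : ℝ) + 2) / v) (((n : ℝ) + 2) ^ a), c n t‖ ≤
      ((n : ℝ) + 1) / T ^ 2 * (∫ t in Icc 0 (((n : ℝ) + 2) / v), |c n t|) +
        ((n : ℝ) + 1) / T ^ 2 * ∫ t in Ioi (((n : ℝ) + 2) ^ a), |c n t| := by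
    filter_upwards [hev] with n hn
    set X : ℝ := ((n : ℝ) + 2) / v with hX
    set Y : ℝ := ((n : ℝ) + 2) ^ a with hY
    have hX0 : 0 ≤ X := by positivity
    have hw : 0 ≤ ((n : ℝ) + 1) / T ^ 2 := by positivity
    -- integrability on the pieces (restrictions of the `Ioi 0` integrability)
    have hI1 : IntegrableOn (c n) (Ioc 0 X) := (hint n).mono_set Ioc_subset_Ioi_self
    have hI2 : IntegrableOn (c n) (Ioc X Y) :=
      (hint n).mono_set fun t ht => lt_of_le_of_lt hX0 ht.1
    have hI3 : IntegrableOn (c n) (Ioi Y) :=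
      (hint n).mono_set fun t ht => lt_of_le_of_lt (hX0.trans hn) ht
    have hI23 : IntegrableOn (c n) (Ioi X) := (hint n).mono_set (Ioi_subset_Ioi hX0)
    -- split the time axis into the three epochs
    have hsplit : ∫ t in Ioi 0, c n t =
        (∫ t in Ioc 0 X, c n t) + (∫ t in Ioc X Y, c n t) + ∫ t in Ioi Y, c n t := by
      rw [← Ioc_union_Ioi_eq_Ioi hX0,
        setIntegral_union Ioc_disjoint_Ioi_same measurableSet_Ioi hI1 hI23,
        ← Ioc_union_Ioi_eq_Ioi hn,
        setIntegral_union Ioc_disjoint_Ioi_same measurableSet_Ioi hI2 hI3, add_assoc]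
    have hmid : ∫ t in Icc X Y, c n t = ∫ t in Ioc X Y, c n t := integral_Icc_eq_integral_Ioc
    have hleft : |∫ t in Ioc 0 X, c n t| ≤ ∫ t in Icc 0 X, |c n t| := by
      rw [integral_Icc_eq_integral_Ioc]
      exact abs_integral_le_integral_abs
    have hright : |∫ t in Ioi Y, c n t| ≤ ∫ t in Ioi Y, |c n t| := abs_integral_le_integral_abs
    rw [Real.norm_eq_abs, ← mul_sub, abs_mul, abs_of_nonneg hw, ← mul_add, hsplit, hmid]
    refine mul_le_mul_of_nonneg_left ?_ hw
    have hrw : (∫ t in Ioc 0 X, c n t) + (∫ t in Ioc X Y, c n t) + (∫ t in Ioi Y, c n t) -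
        (∫ t in Ioc X Y, c n t) = (∫ t in Ioc 0 X, c n t) + ∫ t in Ioi Y, c n t := by ring
    rw [hrw]
    exact (abs_add_le _ _).trans (add_le_add hleft hright)
  -- squeeze: whole − middle → 0, middle → κ
  have hdiff : Tendsto (fun n : ℕ => ((n : ℝ) + 1) / T ^ 2 * (∫ t in Ioi 0, c n t) -
      ((n : ℝ) + 1) / T ^ 2 * ∫ t in Icc (((n : ℝ) + 2) / v) (((n : ℝ) + 2) ^ a), c n t)
      atTop (𝓝 0) := by
    refine squeeze_zero_norm' hbound ?_
    simpa using hW1.add hW3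
  have h := hdiff.add hW2
  simpa using h

/-- **Item stmt-AtomisticToContinuum-11824** (`EchoLimitOfWindows`, route `ContactEchoEpochs`):
the contact Kubo formula (integrability of the echo `c_N` on `(0,∞)`, under `NessUnique`), the
dark-time window `W1`, the equilibrium fluctuation window `W2` and the polynomial gap tail `W3`
together give the contact-echo form of Fourier's law `EchoLimit`, with `κ :=` the `κ` of `W2`. -/
theorem echoLimitOfWindows_proof :
    Summit.AtomisticToContinuum.FouriersLaw.Theses.ContactEchoEpochs.EchoLimitOfWindows := by
  unfold Summit.AtomisticToContinuum.FouriersLaw.Theses.ContactEchoEpochs.EchoLimitOfWindows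
  intro hCK hNU hW1 hW2 hW3 ω₂ lam β γ hω hl hβ hγ T hT
  have hK := hCK ω₂ lam β γ hω hl hβ hγ (hNU ω₂ lam β γ hω hl hβ hγ) T hT
  obtain ⟨v, hv, h1⟩ := hW1 ω₂ lam β γ hω hl hβ hγ T hT
  obtain ⟨κ, hκ, h2⟩ := hW2 ω₂ lam β γ hω hl hβ hγ T hT
  obtain ⟨a, ha, h3i, h3⟩ := hW3 ω₂ lam β γ hω hl hβ hγ T hT
  exact ⟨κ, hκ, tendsto_setIntegral_Ioi_of_three_windows _ T v a κ hv ha (fun n => (hK n).1)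
    h1 (h2 v hv a ha) h3⟩

end Summit.AtomisticToContinuum.FouriersLaw.Theorems
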